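import Mathlib
import Summits.NavierStokesRegularity.FluidComputer.GalerkinEmergenceUpper
import Summits.NavierStokesRegularity.FluidComputer.GalerkinEmergenceCertificate
import HarnessLib

/-!
# The bootstrap's ceiling holds at ALL LARGE Galerkin levels, uniformly on the window (instab g19, cell `ns-blowup`, 2026-08-27)

HONEST FRAMING (human ruling D-0035): nothing here is a claim about Navier–Stokes blow-up.
WHAT THIS IS NOT: not NS — an abstract real-analysis sentence (bounded level generators on an
inner-product space, one head∣tail certificate); no flow or certificate is constructed.

PURPOSE. The per-level block of `GalerkinEmergenceTrue.half_prediction_of_galerkin_limit` (g15) run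
WITHOUT a `GalerkinConvergenceSetting` and ending in the CEILING of `GalerkinEmergenceUpper`: from
ONE head∣tail certificate of record (`GalerkinEmergenceCertificate`'s hypotheses: symmetric
`P_n`-compatible weights `G₁, G₂, D₁, G`, the inequalities `h₁/h₂/hL` on `range P_n`, the tail
inequality, `μ ≤ min(ω₁, ω)`, the bilinear loss (B)), the μ-extended level generators `A_n`, a
normalised `v` with eigen-consistency `‖A_n(P_n v) − λ P_n v‖ → 0`, a margin `C' > C` and the window
condition, EVERY family of level trajectories `u n` (continuous on `[0, T]`, `u n 0 = P_n(ε v)`,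
classical solutions of `y' = A_n y + P_n B(y, y)` on `(0, T)` with continuous nonlinearity) satisfies

  `∀ᶠ n, ∀ t ∈ [0, T], ‖u n t‖ ≤ (3/2) ε e^{λt}`                  (`eventually_norm_le_three_halves`).

This is the level-uniform `H²` bound that instab g19's residence files
(`TransportGalerkinResidenceBox.exists_residence_box`, `TransportGalerkinEmergenceH2`) consume: the
KEEP chain supplies its own residence input.
-/

noncomputable section

namespace Summit.NavierStokesRegularity.FluidComputer.GalerkinLevelCeiling

open Set Filter Topology MeasureTheory intervalIntegral NormedSpace RCLike
open scoped InnerProductSpace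
open Summit.NavierStokesRegularity.FluidComputer.BoundedGeneratorEmergence
open Summit.NavierStokesRegularity.FluidComputer.GalerkinEmergenceLimit
open Summit.NavierStokesRegularity.FluidComputer.GalerkinEmergenceTrue
open Summit.NavierStokesRegularity.FluidComputer.GalerkinEmergenceUpper
open Summit.NavierStokesRegularity.FluidComputer.GalerkinCertificateTransfer

variable {𝕜 E : Type*} [RCLike 𝕜] [NormedAddCommGroup E] [InnerProductSpace 𝕜 E]
  [NormedSpace ℝ E] [CompleteSpace E]

/-- **The ceiling `(3/2) ε e^{λt}` at all large levels, uniformly on the window.** See the module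
docstring. The slack of level `n` is `η_n = ε (M_G e^{(|ω₁|+|λ|)T} T ‖A_n(P_n v) − λP_n v‖ + e^{|λ|T} |‖P_n v‖ − 1|) → 0`
(`GalerkinEmergenceLimit.linear_prediction_slack`), absorbed by the margin `(C' − C)((3/2)ε)²` for all
large `n`; then `GalerkinEmergenceUpper.norm_le_three_halves_of_classical_slack` applies at level `n`
with the certificates transferred to the extended generator (`GalerkinCertificateTransfer`). -/
theorem eventually_norm_le_three_halves (P : ℕ → E →L[ℝ] E) (hPidem : ∀ n, ∀ w : E, P n (P n w) = P n w)
    (htendsto : ∀ w : E, Tendsto (fun n => P n w) atTop (𝓝 w))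
    {A : E → E} {B : E → E → E} (An : ℕ → E →L[ℝ] E) {μ : ℝ}
    (hAn : ∀ n, ∀ w : E, An n w = P n (A (P n w)) + ((μ : 𝕜) • (w - P n w)))
    {G₁ G₂ D₁ G : E →L[ℝ] E}
    (hG₁ : ∀ x y : E, ⟪G₁ x, y⟫_𝕜 = ⟪x, G₁ y⟫_𝕜) (hG₂ : ∀ x y : E, ⟪G₂ x, y⟫_𝕜 = ⟪x, G₂ y⟫_𝕜)
    (hG : ∀ x y : E, ⟪G x, y⟫_𝕜 = ⟪x, G y⟫_𝕜)
    (hG₁P : ∀ n, ∀ w z : E, ⟪G₁ w, P n z⟫_𝕜 = ⟪G₁ (P n w), z⟫_𝕜)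
    (hG₂P : ∀ n, ∀ w z : E, ⟪G₂ w, P n z⟫_𝕜 = ⟪G₂ (P n w), z⟫_𝕜)
    (hD₁P : ∀ n, ∀ w z : E, ⟪D₁ w, P n z⟫_𝕜 = ⟪D₁ (P n w), z⟫_𝕜)
    (hGP : ∀ n, ∀ w z : E, ⟪G w, P n z⟫_𝕜 = ⟪G (P n w), z⟫_𝕜)
    (hG₁pos : ∀ x : E, 0 ≤ re ⟪G₁ x, x⟫_𝕜) {ω c m₂ M₁ : ℝ} (hc : 0 < c) (hm₂ : 0 < m₂)
    (hM₁ : 0 ≤ M₁) (hm₂' : ∀ x : E, m₂ * ‖x‖ ^ 2 ≤ re ⟪G₂ x, x⟫_𝕜)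
    (hD₁ : ∀ x : E, 0 ≤ re ⟪D₁ x, x⟫_𝕜) (hM₁' : ∀ x : E, re ⟪G₁ x, x⟫_𝕜 ≤ M₁ * re ⟪D₁ x, x⟫_𝕜)
    {m M ω₁ : ℝ} (hm0 : 0 < m) (hm : ∀ x : E, m * ‖x‖ ^ 2 ≤ re ⟪G x, x⟫_𝕜)
    (hM : ∀ x : E, re ⟪G x, x⟫_𝕜 ≤ M * ‖x‖ ^ 2)
    (h₁ : ∀ n, ∀ w : E, 2 * re ⟪G₁ (P n w), A (P n w)⟫_𝕜 + c * re ⟪G₂ (P n w), P n w⟫_𝕜 ≤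
      2 * ω * re ⟪G₁ (P n w), P n w⟫_𝕜)
    (h₂ : ∀ n, ∀ w : E, re ⟪G₂ (P n w), A (P n w)⟫_𝕜 ≤ ω * re ⟪G₂ (P n w), P n w⟫_𝕜)
    (hL : ∀ n, ∀ w : E, re ⟪G (P n w), A (P n w)⟫_𝕜 ≤ ω₁ * re ⟪G (P n w), P n w⟫_𝕜)
    (hμ₁ : μ ≤ ω₁) (hμ₂ : μ ≤ ω)
    (htail : ∀ n, ∀ q : E, P n q = 0 →
      2 * μ * re ⟪G₁ q, q⟫_𝕜 + c * re ⟪G₂ q, q⟫_𝕜 ≤ 2 * ω * re ⟪G₁ q, q⟫_𝕜)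
    {calg : ℝ} (hcalg : 0 ≤ calg)
    (hB : ∀ x y : E, Real.sqrt (re ⟪D₁ (B x y), B x y⟫_𝕜) ≤ calg * ‖x‖ * ‖y‖)
    {v : E} (hv1 : ‖v‖ = 1) {lam ε : ℝ} (hgap : ω < 2 * lam) (hlam : 0 ≤ lam) (hε : 0 < ε)
    (hres : Tendsto (fun n => ‖An n (P n v) - lam • P n v‖) atTop (𝓝 0))
    {C' : ℝ}
    (hCC' : Real.sqrt (M₁ / (c * m₂)) * calg * Real.sqrt (Real.pi / (2 * lam - ω)) < C')
    {T : ℝ}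
    (hsmall : ∀ t ∈ Icc 0 T, C' * (3 / 2 : ℝ) ^ 2 * (ε * Real.exp (lam * t)) < 3 / 2 - 1)
    {u : ℕ → ℝ → E} (hu : ∀ n, ContinuousOn (u n) (Icc 0 T)) (hu0 : ∀ n, u n 0 = P n (ε • v))
    (hderiv : ∀ n, ∀ s ∈ Ioo 0 T, HasDerivAt (u n) (An n (u n s) + P n (B (u n s) (u n s))) s)
    (hBu : ∀ n, ContinuousOn (fun s => P n (B (u n s) (u n s))) (Icc 0 T)) :
    ∀ᶠ n in atTop, ∀ t ∈ Icc 0 T, ‖u n t‖ ≤ 3 / 2 * (ε * Real.exp (lam * t)) := by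
  have hG₂pos : ∀ x : E, 0 ≤ re ⟪G₂ x, x⟫_𝕜 := fun x =>
    le_trans (mul_nonneg hm₂.le (sq_nonneg _)) (hm₂' x)
  have hGpos : ∀ x : E, 0 ≤ re ⟪G x, x⟫_𝕜 := fun x =>
    le_trans (mul_nonneg hm0.le (sq_nonneg _)) (hm x)
  set C : ℝ := Real.sqrt (M₁ / (c * m₂)) * calg * Real.sqrt (Real.pi / (2 * lam - ω)) with hC
  set MG : ℝ := Real.sqrt (M / m) with hMG
  have hMG0 : 0 ≤ MG := Real.sqrt_nonneg _
  -- the slack of level n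
  set η : ℕ → ℝ := fun n => ε * (MG * Real.exp ((|ω₁| + |lam|) * T) * T *
    ‖An n (P n v) - lam • P n v‖ + Real.exp (|lam| * T) * |‖P n v‖ - 1|) with hη
  have hη0 : Tendsto η atTop (𝓝 0) := by
    have h1 : Tendsto (fun n => |‖P n v‖ - 1|) atTop (𝓝 0) := by
      have : Tendsto (fun n => ‖P n v‖ - 1) atTop (𝓝 (‖v‖ - 1)) :=
        (htendsto v).norm.sub_const 1
      rw [hv1, sub_self] at this
      simpa using this.abs
    have h2 : Tendsto (fun n => MG * Real.exp ((|ω₁| + |lam|) * T) * T *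
        ‖An n (P n v) - lam • P n v‖ + Real.exp (|lam| * T) * |‖P n v‖ - 1|) atTop (𝓝 0) := by
      simpa using (hres.const_mul (MG * Real.exp ((|ω₁| + |lam|) * T) * T)).add
        (h1.const_mul (Real.exp (|lam| * T)))
    simpa [hη] using h2.const_mul ε
  have hδ : 0 < (C' - C) * ((3 / 2 : ℝ) * ε) ^ 2 := by
    have : 0 < C' - C := sub_pos.2 hCC'
    positivity
  have hev : ∀ᶠ n in atTop, η n < (C' - C) * ((3 / 2 : ℝ) * ε) ^ 2 := hη0.eventually_lt_const hδ
  filter_upwards [hev] with n hn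
  intro t ht
  -- certificates for the extended generator of level n
  have h₁n := two_level_certificate_ext (𝕜 := 𝕜) (hG₁P n) (hG₂P n) (hPidem n) (hAn n) (htail n) (h₁ n)
  have h₂n := weak_certificate_ext (𝕜 := 𝕜) (hG₂P n) (hPidem n) (hAn n) hμ₂ (fun q _ => hG₂pos q) (h₂ n)
  have hLn := strong_certificate_ext (𝕜 := 𝕜) (hGP n) (hPidem n) (hAn n) hμ₁ (fun q _ => hGpos q) (hL n)
  have hBn := bilinear_loss_proj (𝕜 := 𝕜) (hD₁P n) (hPidem n) (fun q _ => hD₁ q) hB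
  have hflow := norm_linearFlow_le_of_generator_form (𝕜 := 𝕜) (An n) hG hm0 hm hM hLn
  have hu0' : u n 0 = ε • P n v := by rw [hu0 n, map_smul]
  have hslack : ∀ s ∈ Icc 0 T,
      |‖exp (s • An n) (u n 0)‖ - ε * Real.exp (lam * s)| ≤ η n := by
    intro s hs
    rw [hu0']
    exact linear_prediction_slack (An n) hMG0 hflow (P n v) hε.le hs
  have hC' : C * ((3 / 2 : ℝ) * ε) ^ 2 + η n ≤ C' * ((3 / 2 : ℝ) * ε) ^ 2 := by nlinarith
  exact norm_le_three_halves_of_classical_slack (𝕜 := 𝕜) (An n) (fun x y => P n (B x y)) hG₁ hG₂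
    hG₁pos hc hm₂ hM₁ hm₂' hD₁ hM₁' h₁n h₂n hgap hlam hε hcalg hBn (hu n) (hBu n) (hderiv n) hslack
    hC' hsmall ht

end Summit.NavierStokesRegularity.FluidComputer.GalerkinLevelCeiling

end
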